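import Literature.MathematicalPhysics.QuantumFieldTheory.Balaban1983to89.B16Sect1Statements

/-!
# `Balaban1983to89.B16Txt357ThirdOrderU1` — T. Bałaban, *Large field renormalization. II. Localization,
exponentiation, and bounds for the 𝐑 operation*, Commun. Math. Phys. **122** (1989) 355–392 [Balaban1989LargeFieldII],
Sect. 1 p. 357: the `V`-term of (1.2) — *"The last term in the exponential is small, because the function V is at
least of third order in the argument. It can be estimated by O(g_k^{1−β})|Λ|"* (SKELETON row **B16.Txt@357**, decl of
record `B16Sect1Statements.Ineq12V`) — PROVED for the ABELIAN model instance (kind «model-instance», Phase 2 of the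
mega-formalization `lit-balaban`, reader/typer block r13 gen 6; HOME `run/shared/lean/pub/lit-balaban/`, rows
`lit-balaban-r13/ROWS-B16.md`).

statement-level skeleton of published theorems with citation tags; proofs where landed; nothing here is a claim about
the Yang–Mills mass gap

PDF held: `paper:balaban1989-cmp122-large-field-ii` (journal page = PDF page + 354); p. 357 [PDF 3] (render
`run/shared/lean/pub/pub-balaban/b2b-balaban-ref1/pages/1989-cmp122-large-field-II/…-p003-x2.png` read as an image by
r13 gen 2 for `B16Sect1Statements` §13); the definition of `V` is [I] = [Balaban1987RG1] (2.8) p. 266 *"Denoting terms of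
at least third order in H₁B′ by V(H₁B′) we get A(V′U_k) = A(U_{k+1}) + ⟨H₁B′, J⟩ + ½⟨H₁B′, Δ₁H₁B′⟩ + V(H₁B′). (2.8)"*
(OCR text `p0018.txt` of `paper:balaban1987-cmp109-rg-i-small-field` re-read by this seat).

MODEL INSTANCE (explicit; nothing else is claimed).  The gauge group is `U(1)`: a configuration enters the localized
Wilson action `A(ζ₀, U) = Σ_p ζ₀(p)[1 − Re tr U(∂p)]` only through its plaquette angles `θ_p` (`Re tr e^{iθ} = cos θ`),
`A(ζ₀, θ) = Σ_p ζ₀(p)(1 − cos θ_p)` (`actionU1`), and the chart `B′ ↦ (exp ig_kH_{1,k}B′)·U₀` of (1.2) shifts the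
angles ADDITIVELY, `θ ↦ θ + g_kφ` with `φ = ∂H_{1,k}B′` linear in `B′` (abelian group: no `D₃`/BCH terms of [I]
(2.6)–(2.7); for non-abelian `G` those terms are part of `V` and are NOT reproduced here).  Then the terms of order
`≥ 3` of [I] (2.8) are EXACTLY the third-order Taylor remainder of `1 − cos`:
`V = A(ζ₀, θ + gφ) − A(ζ₀, θ) − g⟨φ, ζ₀ sin θ⟩ − ½g²⟨φ, ζ₀ cos θ·φ⟩ = Σ_p ζ₀(p)·rem₃(θ_p, gφ_p)` (`V12`, `V12_eq_sum_rem3`)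
with `rem₃(θ, h) = cos θ·(1 − h²/2 − cos h) + sin θ·(sin h − h)` (`rem3`, `rem3_eq`).  PROVED: `|rem₃(θ, h)| ≤ |h|³/4`
for `|h| ≤ 1` (`abs_rem3_le`, from Mathlib's `Real.cos_bound`/`Real.sin_bound`), hence `|g⁻²V| ≤ (g/4)Σ_p ζ₀(p)|φ_p|³
≤ (g/4)Φ³·#plaquettes` (`abs_V12_div_le`), and the row AS TYPED `Ineq12V (g⁻²V) C g β |Λ|` with
`C = K³c_βc_Λ/4` under the printed bookkeeping `|φ_p| ≤ Φ ≤ K·p₀(g_k)` (the support `|B′| < M₀g_k⁻¹ε_k`,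
`ε_k = g_kA₀p₀(g_k)`, `φ = ∂H_{1,k}B′` bounded), `p₀(g_k)³ ≤ c_β g_k^{−β}` (a power of `log g_k⁻²` against `g_k^{−β}`) and
`#plaquettes ≤ c_Λ|Λ|` (`ineq12V_U1`).  Mathlib + `B16Sect1Statements` only; no `sorry`, no new `def … : Prop`.
-/

namespace Literature.MathematicalPhysics.QuantumFieldTheory.Balaban1983to89.B16Txt357ThirdOrderU1

open Literature.MathematicalPhysics.QuantumFieldTheory.Balaban1983to89
open Real Finset B16Sect1Statements

noncomputable section

/-! ## §1. The third-order Taylor remainder of the `U(1)` plaquette action `1 − cos` -/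

/-- `rem₃(θ, h) = [1 − cos(θ + h)] − [1 − cos θ] − h sin θ − ½h² cos θ`: the terms of order `≥ 3` in `h` of the `U(1)`
plaquette action at the background angle `θ` — the one-plaquette `V` of [I] (2.8) in the abelian model.
[cite: Balaban1989LargeFieldII, (1.2) p.357] -/
def rem3 (θ h : ℝ) : ℝ := (1 - cos (θ + h)) - (1 - cos θ) - h * sin θ - h ^ 2 / 2 * cos θ

/-- The addition formula puts the remainder in the form `cos θ·(1 − h²/2 − cos h) + sin θ·(sin h − h)`.
[cite: Balaban1989LargeFieldII, (1.2) p.357] -/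
theorem rem3_eq (θ h : ℝ) : rem3 θ h = cos θ * (1 - h ^ 2 / 2 - cos h) + sin θ * (sin h - h) := by
  unfold rem3
  rw [cos_add]
  ring

/-- **`V` is of third order**: `|rem₃(θ, h)| ≤ |h|³/4` for `|h| ≤ 1` (from `|cos h − (1 − h²/2)| ≤ (5/96)h⁴` and
`|sin h − (h − h³/6)| ≤ |h|⁵/100`, Mathlib `Real.cos_bound`/`Real.sin_bound`; `5/96 + 1/6 + 1/100 < 1/4`).
[cite: Balaban1989LargeFieldII, (1.2) p.357] -/
theorem abs_rem3_le {θ h : ℝ} (hh : |h| ≤ 1) : |rem3 θ h| ≤ |h| ^ 3 / 4 := by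
  rw [rem3_eq]
  have h0 : 0 ≤ |h| := abs_nonneg h
  have hcos := Real.cos_bound hh
  have hsin := Real.sin_bound hh
  have h4 : |h| ^ 4 ≤ |h| ^ 3 := by
    calc |h| ^ 4 = |h| ^ 3 * |h| := by ring
      _ ≤ |h| ^ 3 * 1 := mul_le_mul_of_nonneg_left hh (by positivity)
      _ = |h| ^ 3 := by ring
  have h5 : |h| ^ 5 ≤ |h| ^ 3 := by
    calc |h| ^ 5 = |h| ^ 3 * (|h| * |h|) := by ring
      _ ≤ |h| ^ 3 * (1 * 1) := mul_le_mul_of_nonneg_left (mul_le_mul hh hh h0 zero_le_one) (by positivity)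
      _ = |h| ^ 3 := by ring
  -- the two elementary pieces
  have hA : |1 - h ^ 2 / 2 - cos h| ≤ 5 / 96 * |h| ^ 3 := by
    rw [show 1 - h ^ 2 / 2 - cos h = -(cos h - (1 - h ^ 2 / 2)) by ring, abs_neg]
    linarith
  have hB : |sin h - h| ≤ (1 / 6 + 1 / 100) * |h| ^ 3 := by
    have h1 : sin h - h = (sin h - (h - h ^ 3 / 6)) + (-(h ^ 3 / 6)) := by ring
    rw [h1]
    refine (abs_add_le _ _).trans ?_
    have h2 : |(-(h ^ 3 / 6))| = |h| ^ 3 / 6 := by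
      rw [abs_neg, abs_div, abs_pow, abs_of_pos (by norm_num : (0 : ℝ) < 6)]
    rw [h2]
    linarith
  have hcosθ : |cos θ| ≤ 1 := abs_cos_le_one θ
  have hsinθ : |sin θ| ≤ 1 := abs_sin_le_one θ
  calc |cos θ * (1 - h ^ 2 / 2 - cos h) + sin θ * (sin h - h)|
      ≤ |cos θ * (1 - h ^ 2 / 2 - cos h)| + |sin θ * (sin h - h)| := abs_add_le _ _
    _ = |cos θ| * |1 - h ^ 2 / 2 - cos h| + |sin θ| * |sin h - h| := by rw [abs_mul, abs_mul]
    _ ≤ 1 * (5 / 96 * |h| ^ 3) + 1 * ((1 / 6 + 1 / 100) * |h| ^ 3) :=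
        add_le_add (mul_le_mul hcosθ hA (abs_nonneg _) zero_le_one)
          (mul_le_mul hsinθ hB (abs_nonneg _) zero_le_one)
    _ ≤ |h| ^ 3 / 4 := by nlinarith [pow_nonneg h0 3]

/-! ## §2. The `V`-term of (1.2) in the abelian model -/

variable {ι : Type*} [Fintype ι]

/-- The localized `U(1)` Wilson action in plaquette-angle coordinates, `A(ζ₀, θ) = Σ_p ζ₀(p)(1 − cos θ_p)`
(`Re tr e^{iθ_p} = cos θ_p` in `A(ζ, U) = Σ_p ζ(p)[1 − Re tr U(∂p)]`, `B16Sect1Wilson.wilsonLoc`).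
[cite: Balaban1989LargeFieldII, (1.1) p.356] -/
def actionU1 (ζ θ : ι → ℝ) : ℝ := ∑ p, ζ p * (1 - cos (θ p))

/-- The `V`-term of (1.2) in the abelian model: `V = A(ζ₀, θ + gφ) − A(ζ₀, θ) − g⟨φ, ζ₀ sin θ⟩ − ½g²⟨φ, ζ₀ cos θ·φ⟩`,
the terms of order `≥ 3` of the expansion [I] (2.8) of the localized Wilson action along the chart `θ ↦ θ + gφ`,
`φ = ∂H_{1,k}B′`. [cite: Balaban1989LargeFieldII, (1.2) p.357] -/
def V12 (g : ℝ) (ζ θ φ : ι → ℝ) : ℝ :=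
  actionU1 ζ (fun p => θ p + g * φ p) - actionU1 ζ θ - g * ∑ p, ζ p * φ p * sin (θ p)
    - g ^ 2 / 2 * ∑ p, ζ p * φ p ^ 2 * cos (θ p)

/-- `V = Σ_p ζ₀(p)·rem₃(θ_p, gφ_p)`. [cite: Balaban1989LargeFieldII, (1.2) p.357] -/
theorem V12_eq_sum_rem3 (g : ℝ) (ζ θ φ : ι → ℝ) : V12 g ζ θ φ = ∑ p, ζ p * rem3 (θ p) (g * φ p) := by
  unfold V12 actionU1 rem3
  simp only [Finset.mul_sum, ← Finset.sum_sub_distrib]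
  refine Finset.sum_congr rfl fun p _ => ?_
  ring

/-- `|V| ≤ ¼ Σ_p ζ₀(p)|gφ_p|³` for a weight `0 ≤ ζ₀ ≤ 1` and increments `|gφ_p| ≤ 1`.
[cite: Balaban1989LargeFieldII, (1.2) p.357] -/
theorem abs_V12_le {g : ℝ} {ζ θ φ : ι → ℝ} (hζ : ∀ p, 0 ≤ ζ p) (hφ : ∀ p, |g * φ p| ≤ 1) :
    |V12 g ζ θ φ| ≤ 1 / 4 * ∑ p, ζ p * |g * φ p| ^ 3 := by
  rw [V12_eq_sum_rem3, Finset.mul_sum]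
  refine (abs_sum_le_sum_abs _ _).trans (sum_le_sum fun p _ => ?_)
  rw [abs_mul, abs_of_nonneg (hζ p)]
  have := abs_rem3_le (θ := θ p) (hφ p)
  calc ζ p * |rem3 (θ p) (g * φ p)| ≤ ζ p * (|g * φ p| ^ 3 / 4) := mul_le_mul_of_nonneg_left this (hζ p)
    _ = 1 / 4 * (ζ p * |g * φ p| ^ 3) := by ring

/-- **`|g⁻²V| ≤ (g/4)Φ³·#plaquettes`**: with `0 ≤ ζ₀ ≤ 1`, `|φ_p| ≤ Φ` and `gΦ ≤ 1` (`g > 0`) — the mechanism of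
*"small, because the function V is at least of third order in the argument"*: two powers of `g` cancel the `g⁻²`,
one is left. [cite: Balaban1989LargeFieldII, (1.2) p.357] -/
theorem abs_V12_div_le {g Φ : ℝ} {ζ θ φ : ι → ℝ} (hg : 0 < g) (hζ : ∀ p, 0 ≤ ζ p ∧ ζ p ≤ 1)
    (hΦ : ∀ p, |φ p| ≤ Φ) (hgΦ : g * Φ ≤ 1) :
    |1 / g ^ 2 * V12 g ζ θ φ| ≤ g / 4 * Φ ^ 3 * Fintype.card ι := by
  have hgφ : ∀ p, |g * φ p| ≤ g * Φ := fun p => by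
    rw [abs_mul, abs_of_pos hg]; exact mul_le_mul_of_nonneg_left (hΦ p) hg.le
  have hφ1 : ∀ p, |g * φ p| ≤ 1 := fun p => (hgφ p).trans hgΦ
  have hV := abs_V12_le (θ := θ) (fun p => (hζ p).1) hφ1
  have hsum : ∑ p, ζ p * |g * φ p| ^ 3 ≤ ∑ _p : ι, (g * Φ) ^ 3 := by
    refine sum_le_sum fun p _ => ?_
    have h1 : |g * φ p| ^ 3 ≤ (g * Φ) ^ 3 := pow_le_pow_left₀ (abs_nonneg _) (hgφ p) 3
    have h2 : ζ p * |g * φ p| ^ 3 ≤ 1 * |g * φ p| ^ 3 :=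
      mul_le_mul_of_nonneg_right (hζ p).2 (by positivity)
    linarith
  rw [sum_const, card_univ, nsmul_eq_mul] at hsum
  rw [abs_mul, abs_of_pos (by positivity : (0 : ℝ) < 1 / g ^ 2)]
  have hg2 : (0 : ℝ) < g ^ 2 := by positivity
  calc 1 / g ^ 2 * |V12 g ζ θ φ| ≤ 1 / g ^ 2 * (1 / 4 * ((Fintype.card ι : ℝ) * (g * Φ) ^ 3)) :=
        mul_le_mul_of_nonneg_left (hV.trans (by linarith)) (by positivity)
    _ = g / 4 * Φ ^ 3 * Fintype.card ι := by field_simp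

/-! ## §3. Row B16.Txt@357 AS TYPED for the abelian model -/

/-- **Row B16.Txt@357 PROVED for the abelian model instance, AS TYPED** (`B16Sect1Statements.Ineq12V`): with the
printed bookkeeping — the support `χ({|B′| < M₀g_k⁻¹ε_k})` of (1.2) and `ε_k = g_kA₀p₀(g_k)` give
`|φ_p| = |(∂H_{1,k}B′)(p)| ≤ Φ ≤ K·p₀(g_k)` (`K = ‖∂H_{1,k}‖M₀A₀`), `g_kΦ ≤ 1` for `g_k` small, the logarithmic growth
`p₀(g_k)³ ≤ c_β g_k^{−β}`, and `#plaquettes(Λ) ≤ c_Λ|Λ|` — the `V`-term obeys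
`|g_k⁻²V| ≤ (K³c_βc_Λ/4)·g_k^{1−β}·|Λ|`, i.e. *"It can be estimated by O(g_k^{1−β})|Λ|"* with the `O(·)` explicit.
[cite: Balaban1989LargeFieldII, (1.2) p.357] -/
theorem ineq12V_U1 {g Φ K p₀g cβ β cΛ volΛ : ℝ} {ζ θ φ : ι → ℝ} (hg : 0 < g)
    (hζ : ∀ p, 0 ≤ ζ p ∧ ζ p ≤ 1) (hΦ : ∀ p, |φ p| ≤ Φ) (hΦ0 : 0 ≤ Φ) (hgΦ : g * Φ ≤ 1)
    (hK : Φ ≤ K * p₀g) (hp0 : 0 ≤ p₀g) (hK0 : 0 ≤ K) (hp : p₀g ^ 3 ≤ cβ * g ^ (-β))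
    (hcard : (Fintype.card ι : ℝ) ≤ cΛ * volΛ) :
    Ineq12V (1 / g ^ 2 * V12 g ζ θ φ) (K ^ 3 * cβ * cΛ / 4) g β volΛ := by
  unfold Ineq12V
  have h1 := abs_V12_div_le (θ := θ) hg hζ hΦ hgΦ
  have hΦ3 : Φ ^ 3 ≤ (K * p₀g) ^ 3 := pow_le_pow_left₀ hΦ0 hK 3
  have hgβ : 0 < g ^ (-β) := Real.rpow_pos_of_pos hg _
  have hcβ0 : 0 ≤ cβ := by
    have : 0 ≤ cβ * g ^ (-β) := (pow_nonneg hp0 3).trans hp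
    by_contra hneg
    have : cβ * g ^ (-β) < 0 := mul_neg_of_neg_of_pos (not_le.mp hneg) hgβ
    linarith
  have h2 : Φ ^ 3 ≤ K ^ 3 * (cβ * g ^ (-β)) := by
    calc Φ ^ 3 ≤ (K * p₀g) ^ 3 := hΦ3
      _ = K ^ 3 * p₀g ^ 3 := by ring
      _ ≤ K ^ 3 * (cβ * g ^ (-β)) := mul_le_mul_of_nonneg_left hp (by positivity)
  have hrpow : g ^ (1 - β) = g * g ^ (-β) := by
    rw [sub_eq_add_neg, Real.rpow_add hg, Real.rpow_one]
  have hcoef : 0 ≤ g / 4 * (K ^ 3 * (cβ * g ^ (-β))) := by positivity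
  calc |1 / g ^ 2 * V12 g ζ θ φ| ≤ g / 4 * Φ ^ 3 * Fintype.card ι := h1
    _ ≤ g / 4 * (K ^ 3 * (cβ * g ^ (-β))) * Fintype.card ι :=
        mul_le_mul_of_nonneg_right (mul_le_mul_of_nonneg_left h2 (by positivity)) (by positivity)
    _ ≤ g / 4 * (K ^ 3 * (cβ * g ^ (-β))) * (cΛ * volΛ) := mul_le_mul_of_nonneg_left hcard hcoef
    _ = K ^ 3 * cβ * cΛ / 4 * g ^ (1 - β) * volΛ := by rw [hrpow]; ring

end

end Literature.MathematicalPhysics.QuantumFieldTheory.Balaban1983to89.B16Txt357ThirdOrderU1
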